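import Mathlib.Analysis.InnerProductSpace.Basic
import Mathlib.Analysis.Complex.CauchyIntegral
import Literature.Analysis.OperatorTheory.PseudoResolventOperator
import Literature.Analysis.OperatorTheory.RankOnePencilSimpleZero
import HarnessLib

/-!
# Rank-one perturbation of an UNBOUNDED operator given through its resolvent: the Evans-function
# criterion, its derivative, and «simple zero ⇒ algebraically simple eigenvalue» — resolvent-keyed

`Literature/Analysis/OperatorTheory`; proofs-layer file (theorems only; no definitions, no named facts).  The files
`CoercivePencilResolvent.lean` / `RankOnePencilSimpleZero.lean` key the rank-one (Evans-function) eigenvalue criterion on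
a BOUNDED pencil `A + σK`.  A differential operator (e.g. a linearisation `𝒜` containing an unbounded drift `½ξ∂_ξ`) is
not a bounded operator on its energy space; what IS bounded is its RESOLVENT.  This file restates the three sentences a
spectral certificate needs with the resolvent family as the ONLY primitive object: a pseudo-resolvent
`J : ℂ → (X →L[ℂ] X)` on an open set `U` (`Literature.Analysis.OperatorTheory.IsPseudoResolvent`, Kato VIII-§1.1: the
resolvent identity `J z − J w = (w − z) J z J w`; for `J(σ) = (𝒜 + σ)⁻¹ = (σ − T)⁻¹`, `T = −𝒜`), the closed operator
`T = operatorOfResolvent J z₀` it defines (`PseudoResolventOperator.lean`), a vector `f` and a functional `ℓ` (the rank-one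
perturbation `F u = θ ℓ(u) f`).

**§1 (calculus of a pseudo-resolvent).**  `J` has derivative `−J(z)²` at every `z ∈ U` (`IsPseudoResolvent.hasDerivAt`);
the EVANS FUNCTION `E(σ) := 1 − θ ℓ(J(σ) f)` (more generally `1 − θ φ(J σ)` for `φ ∈ A*`) is analytic on `U` with
`E′(σ₀) = θ ℓ(J(σ₀)² f)` (`analyticOnNhd_evans`, `hasDerivAt_evans`, `deriv_evans`) [cite: Kato1966, VIII-§1.1 (1.1)–(1.2)
and I-§5.2 (5.5)–(5.8)]; and the coercivity-on-the-range bound `c‖J σ v‖² ≤ Re⟪v, J σ v⟫ ⇒ ‖J σ v‖ ≤ c⁻¹‖v‖`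
(`norm_apply_le_of_re_coercive_range`) [cite: Kato1966, V-§3.10 (3.38), elementary case].

**§2 (the dictionary).**  For `σ, z₀ ∈ U` and `T = operatorOfResolvent J z₀`: `u ∈ dom T ∧ T u = σu − θℓ(u) f`
(`σ` is an eigenvalue of `T + F`, eigenvector `u`) iff `u = θ ℓ(u) • J(σ) f` (`eigen_rankOne_iff`); and
`δ₁ ∈ dom T ∧ T δ₁ = σδ₁ − θℓ(δ₁) f + δ₀` (a generalized eigenvector: `(T + F − σ)δ₁ = δ₀`) iff
`δ₁ − θℓ(δ₁) • J(σ) f = −J(σ) δ₀` (`jordanChain_rankOne_iff`) [cite: Kato1966, VIII-§1.1 p. 428 and III-§6.5].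

**§3 (the certificate's sentences, resolvent-keyed).**  `(∃ u ≠ 0, u = θℓ(u) • J(σ) f) ⇔ E(σ) = 0`
(`kernel_rankOne_iff_evans`, from `rankOne_kernel_iff` with `P = R = 1`); in the singular case the eigenvectors are the
multiples of `J(σ) f ≠ 0` and a generalized eigenvector exists iff `θ ℓ(J(σ)² f) = 0` iff `E′(σ) = 0`
(`jordanChain_rankOne_iff_deriv`); hence **`algebraicallySimple_of_analyticOrderAt_eq_one`**: if `E` vanishes at `σ` to order
exactly one then `σ` is a geometrically and algebraically simple eigenvalue of `T + F` [cite: Kato1966, III-§6.5 and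
IV-§1.4 Thm. 1.16, elementary rank-one case] — the elementary substitute for the Gohberg–Sigal multiplicity theorem.

MOTIVATION (provenance only): cell ns-blowup, case Z3-SR-SPEC (profile-lead (dx)(4)/(eb)(3); selfsim g9's design note
«key (P1)/(P2) on the resolvent R(σ)»): `X = L²_w` (complex), `J(σ) = R(σ) = (A_F + σ)⁻¹`, `T = −A_F`, `F = θ (v₀, ·)_E Jh`,
so `T + F = −DG(Ω*)`; the EXISTENCE of `R(σ)` with its bound (the MODEL-ASSEMBLY item (β)) is the input, everything after it
is kernel by the names above.  WHAT THIS IS NOT: nothing about Navier–Stokes or Euler; abstract operator theory.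

## References
* [Kato1966] T. Kato, *Perturbation Theory for Linear Operators*, Springer 1966, I-§5.2, III-§6.5, IV-§1.4 Thm. 1.16,
  V-§3.10, VIII-§1.1.
-/

noncomputable section

open Set Filter Topology
open scoped InnerProductSpace

namespace Literature.Analysis.OperatorTheory

namespace IsPseudoResolvent

/-! ### §1 Derivative of a pseudo-resolvent; the Evans function is analytic with `E′ = θ ℓ(J² f)` -/

section Calculus

variable {A : Type*} [NormedRing A] [NormedAlgebra ℂ A] [CompleteSpace A]
variable {U : Set ℂ} {J : ℂ → A}

/-- **The derivative of a pseudo-resolvent** on an open set: `J′(z) = −J(z)²` (difference quotients from the resolvent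
identity, `(J w − J z)/(w − z) = −J w J z`, and continuity of `J`). [cite: Kato1966, VIII-§1.1 (1.2) and I-§5.2 (5.8)] -/
protected theorem hasDerivAt (h : IsPseudoResolvent U J) (hU : IsOpen U) {z : ℂ} (hz : z ∈ U) :
    HasDerivAt J (-(J z * J z)) z := by
  have hc : ContinuousAt J z := ((h.differentiableOn hU z hz).differentiableAt (hU.mem_nhds hz)).continuousAt
  rw [hasDerivAt_iff_tendsto_slope]
  have key : ∀ᶠ w in 𝓝[≠] z, -(J w * J z) = slope J z w := by
    filter_upwards [self_mem_nhdsWithin, mem_nhdsWithin_of_mem_nhds (hU.mem_nhds hz)] with w hw hwU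
    have hne : (w - z : ℂ) ≠ 0 := sub_ne_zero.2 hw
    rw [slope_def_module, h hwU hz, smul_smul, show (w - z)⁻¹ * (z - w) = -1 by field_simp; ring, neg_one_smul]
  refine Filter.Tendsto.congr' key ?_
  exact (((hc.mul continuousAt_const).neg).tendsto).mono_left nhdsWithin_le_nhds

/-- A pseudo-resolvent on an open set is analytic there (holomorphic = analytic over `ℂ`).
[cite: Kato1966, VIII-§1.1 (1.1)] -/
protected theorem analyticOnNhd (h : IsPseudoResolvent U J) (hU : IsOpen U) : AnalyticOnNhd ℂ J U :=
  (h.differentiableOn hU).analyticOnNhd hU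

/-- **Derivative of the Evans function** `E(σ) = 1 − θ φ(J σ)` for a bounded functional `φ` on the algebra:
`E′(σ₀) = θ φ(J(σ₀)²)`. [cite: Kato1966, VIII-§1.1 (1.2), elementary consequence] -/
theorem hasDerivAt_evans' (h : IsPseudoResolvent U J) (hU : IsOpen U) {σ₀ : ℂ} (hσ : σ₀ ∈ U)
    (φ : A →L[ℂ] ℂ) (θ : ℂ) :
    HasDerivAt (fun σ => 1 - θ * φ (J σ)) (θ * φ (J σ₀ * J σ₀)) σ₀ := by
  have h1 : HasDerivAt (fun σ => φ (J σ)) (φ (-(J σ₀ * J σ₀))) σ₀ :=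
    φ.hasFDerivAt.comp_hasDerivAt σ₀ (h.hasDerivAt hU hσ)
  simpa using (h1.const_mul θ).const_sub 1

/-- The Evans function `1 − θ φ(J σ)` is analytic on `U`. [cite: Kato1966, VIII-§1.1 (1.1)] -/
theorem analyticOnNhd_evans' (h : IsPseudoResolvent U J) (hU : IsOpen U) (φ : A →L[ℂ] ℂ) (θ : ℂ) :
    AnalyticOnNhd ℂ (fun σ => 1 - θ * φ (J σ)) U := fun σ hσ =>
  analyticAt_const.sub (analyticAt_const.mul ((φ.analyticAt _).comp (h.analyticOnNhd hU σ hσ)))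

end Calculus

section Operator

variable {X : Type*} [NormedAddCommGroup X] [NormedSpace ℂ X] [CompleteSpace X]
variable {U : Set ℂ} {J : ℂ → X →L[ℂ] X}

/-- **Derivative of the Evans function**, operator form: `E(σ) = 1 − θ ℓ(J(σ) f)` has `E′(σ₀) = θ ℓ(J(σ₀) (J(σ₀) f))`.
[cite: Kato1966, VIII-§1.1 (1.2), elementary consequence] -/
theorem hasDerivAt_evans (h : IsPseudoResolvent U J) (hU : IsOpen U) {σ₀ : ℂ} (hσ : σ₀ ∈ U)
    (ℓ : X →L[ℂ] ℂ) (f : X) (θ : ℂ) :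
    HasDerivAt (fun σ => 1 - θ * ℓ (J σ f)) (θ * ℓ (J σ₀ (J σ₀ f))) σ₀ := by
  have := h.hasDerivAt_evans' hU hσ (ℓ.comp (ContinuousLinearMap.apply ℂ X f)) θ
  simpa [mul_apply_eq_comp] using this

/-- `deriv` form. [cite: Kato1966, VIII-§1.1 (1.2), elementary consequence] -/
theorem deriv_evans (h : IsPseudoResolvent U J) (hU : IsOpen U) {σ₀ : ℂ} (hσ : σ₀ ∈ U)
    (ℓ : X →L[ℂ] ℂ) (f : X) (θ : ℂ) :
    deriv (fun σ => 1 - θ * ℓ (J σ f)) σ₀ = θ * ℓ (J σ₀ (J σ₀ f)) :=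
  (h.hasDerivAt_evans hU hσ ℓ f θ).deriv

/-- The Evans function `1 − θ ℓ(J σ f)` is analytic on `U` — the hypothesis under which the tree's argument-principle files
count its zeros. [cite: Kato1966, VIII-§1.1 (1.1)] -/
theorem analyticOnNhd_evans (h : IsPseudoResolvent U J) (hU : IsOpen U) (ℓ : X →L[ℂ] ℂ) (f : X) (θ : ℂ) :
    AnalyticOnNhd ℂ (fun σ => 1 - θ * ℓ (J σ f)) U := by
  have := h.analyticOnNhd_evans' hU (ℓ.comp (ContinuousLinearMap.apply ℂ X f)) θ
  simpa using this

end Operator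

/-- **Coercivity on the range gives the resolvent bound**: if `c‖J v‖² ≤ Re⟪v, J v⟫` for all `v` (`c > 0`) then
`‖J v‖ ≤ c⁻¹‖v‖` — the sentence «`‖R(σ)‖ ≤ 1/c_w(σ)`» keyed on the resolvent alone.
[cite: Kato1966, V-§3.10 (3.38) (accretive operators), elementary case] -/
theorem norm_apply_le_of_re_coercive_range {X : Type*} [NormedAddCommGroup X] [InnerProductSpace ℂ X]
    (R : X →L[ℂ] X) {c : ℝ} (hc : 0 < c) (hR : ∀ v, c * ‖R v‖ ^ 2 ≤ RCLike.re ⟪v, R v⟫_ℂ) (v : X) :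
    ‖R v‖ ≤ c⁻¹ * ‖v‖ := by
  have h1 : c * ‖R v‖ ^ 2 ≤ ‖v‖ * ‖R v‖ := (hR v).trans (re_inner_le_norm v (R v))
  rcases eq_or_ne (R v) 0 with h0 | h0
  · rw [h0, norm_zero]; positivity
  · have hpos : 0 < ‖R v‖ := norm_pos_iff.2 h0
    rw [le_inv_mul_iff₀ hc]; nlinarith

/-! ### §2 The dictionary: eigenvectors and generalized eigenvectors of `T + θℓ(·)f` through the resolvent -/

section Dictionary

variable {X : Type*} [NormedAddCommGroup X] [NormedSpace ℂ X]
variable {U : Set ℂ} {J : ℂ → X →L[ℂ] X} {z₀ : ℂ} {hinj : Function.Injective (J z₀)}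

/-- **Eigen-equation through the resolvent.**  For `σ ∈ U`: `u ∈ dom T` with `T u = σu − θℓ(u) f` (i.e. `(T + F)u = σu`,
`F = θℓ(·)f`) iff `u = θℓ(u) • J(σ) f`. [cite: Kato1966, VIII-§1.1 p. 428 (the operator defined by a pseudo-resolvent)] -/
theorem eigen_rankOne_iff (h : IsPseudoResolvent U J) (hz₀ : z₀ ∈ U) {σ : ℂ} (hσ : σ ∈ U)
    (ℓ : X →L[ℂ] ℂ) (f : X) (θ : ℂ) (u : X) :
    (∃ hu : u ∈ (operatorOfResolvent J z₀ hinj).domain,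
        operatorOfResolvent J z₀ hinj ⟨u, hu⟩ = σ • u - (θ * ℓ u) • f) ↔ u = (θ * ℓ u) • J σ f := by
  constructor
  · rintro ⟨hu, hT⟩
    have h1 := h.resolvent_apply_sub hz₀ hσ hu
    rw [hT, sub_sub_cancel, map_smul] at h1
    exact h1.symm
  · intro hu
    have hmem : u ∈ (operatorOfResolvent J z₀ hinj).domain := by
      rw [hu]; exact Submodule.smul_mem _ _ (h.apply_mem_domain_of_mem hz₀ hσ f)
    refine ⟨hmem, ?_⟩
    have h2 := h.apply_resolvent_of_mem (hinj := hinj) hz₀ hσ ((θ * ℓ u) • f)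
    have heq : (⟨J σ ((θ * ℓ u) • f), h.apply_mem_domain_of_mem hz₀ hσ _⟩ :
        (operatorOfResolvent J z₀ hinj).domain) = ⟨u, hmem⟩ := by
      apply Subtype.ext; simp only [map_smul]; exact hu.symm
    rw [heq] at h2
    rw [h2, map_smul, ← hu]

/-- **Generalized eigenvectors through the resolvent.**  For `σ ∈ U`: `δ₁ ∈ dom T` with
`T δ₁ = σδ₁ − θℓ(δ₁) f + δ₀` (i.e. `(T + F − σ)δ₁ = δ₀`) iff `δ₁ − θℓ(δ₁) • J(σ) f = −J(σ) δ₀`.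
[cite: Kato1966, VIII-§1.1 p. 428 and III-§6.5] -/
theorem jordanChain_rankOne_iff (h : IsPseudoResolvent U J) (hz₀ : z₀ ∈ U) {σ : ℂ} (hσ : σ ∈ U)
    (ℓ : X →L[ℂ] ℂ) (f : X) (θ : ℂ) (δ₀ δ₁ : X) :
    (∃ hu : δ₁ ∈ (operatorOfResolvent J z₀ hinj).domain,
        operatorOfResolvent J z₀ hinj ⟨δ₁, hu⟩ = σ • δ₁ - (θ * ℓ δ₁) • f + δ₀) ↔
      δ₁ - (θ * ℓ δ₁) • J σ f = -(J σ δ₀) := by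
  set c : ℂ := θ * ℓ δ₁ with hc
  constructor
  · rintro ⟨hu, hT⟩
    have h1 := h.resolvent_apply_sub hz₀ hσ hu
    rw [hT, show σ • δ₁ - (σ • δ₁ - c • f + δ₀) = c • f - δ₀ by abel, map_sub, map_smul] at h1
    rw [← h1]; abel
  · intro hδ
    have h' : δ₁ = -(J σ δ₀) + c • J σ f := by rw [← sub_eq_iff_eq_add]; exact hδ
    have hrep : J σ (c • f - δ₀) = δ₁ := by rw [map_sub, map_smul, h']; abel
    have hmem : δ₁ ∈ (operatorOfResolvent J z₀ hinj).domain := by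
      rw [← hrep]; exact h.apply_mem_domain_of_mem hz₀ hσ _
    refine ⟨hmem, ?_⟩
    have h2 := h.apply_resolvent_of_mem (hinj := hinj) hz₀ hσ (c • f - δ₀)
    have heq : (⟨J σ (c • f - δ₀), h.apply_mem_domain_of_mem hz₀ hσ _⟩ :
        (operatorOfResolvent J z₀ hinj).domain) = ⟨δ₁, hmem⟩ := by
      apply Subtype.ext; exact hrep
    rw [heq] at h2
    rw [h2, hrep]; abel

end Dictionary

/-! ### §3 The certificate's sentences, keyed on the resolvent -/

section Sentences

variable {X : Type*} [NormedAddCommGroup X] [NormedSpace ℂ X]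

/-- **Eigenvalue iff zero of the Evans function**, resolvent-keyed: `(∃ u ≠ 0, u = θℓ(u) • R f) ⇔ 1 − θℓ(R f) = 0`
(`rankOne_kernel_iff` with `P = R = 1`; here `R = J(σ)`). [cite: Kato1966, III-§4.3, (4.13) (rank one)] -/
theorem kernel_rankOne_iff_evans (R : X →L[ℂ] X) (ℓ : X →L[ℂ] ℂ) (f : X) (θ : ℂ) :
    (∃ u, u ≠ 0 ∧ u = (θ * ℓ u) • R f) ↔ 1 - θ * ℓ (R f) = 0 := by
  have key := rankOne_kernel_iff (1 : X →L[ℂ] X) 1 (fun _ => rfl) (fun _ => rfl) (R f) (θ • ℓ)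
  have hQ : ∀ u, ((1 : X →L[ℂ] X) - (θ • ℓ).smulRight (R f)) u = 0 ↔ u = (θ * ℓ u) • R f := fun u => by
    simp only [sub_apply, one_apply_eq_self, ContinuousLinearMap.smulRight_apply, smul_apply, smul_eq_mul, sub_eq_zero]
  simp only [hQ, one_apply_eq_self, smul_apply, smul_eq_mul] at key
  rw [key, sub_eq_zero, eq_comm]

/-- In the singular case `θℓ(R f) = 1`, for an eigenvector `δ₀ ≠ 0` (`δ₀ = θℓ(δ₀) • R f`): a solution of
`δ₁ − θℓ(δ₁) • R f = −R δ₀` exists iff `θ ℓ(R (R f)) = 0` (`rankOne_jordanChain_iff_of_kernel` with `P = R = 1`,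
`K = R`). [cite: Kato1966, III-§6.5, elementary rank-one case] -/
theorem jordanChain_rankOne_iff_of_eigen (R : X →L[ℂ] X) (ℓ : X →L[ℂ] ℂ) (f : X) (θ : ℂ)
    (h1 : θ * ℓ (R f) = 1) {δ₀ : X} (hδ : δ₀ = (θ * ℓ δ₀) • R f) (hδ0 : δ₀ ≠ 0) :
    (∃ δ₁, δ₁ - (θ * ℓ δ₁) • R f = -(R δ₀)) ↔ θ * ℓ (R (R f)) = 0 := by
  have h1' : (θ • ℓ) ((1 : X →L[ℂ] X) (R f)) = 1 := by simpa [smul_eq_mul] using h1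
  have hδ' : ((1 : X →L[ℂ] X) - (θ • ℓ).smulRight ((1 : X →L[ℂ] X) (R f))) δ₀ = 0 := by
    simp only [sub_apply, one_apply_eq_self, ContinuousLinearMap.smulRight_apply, smul_apply, smul_eq_mul, sub_eq_zero]
    exact hδ
  have key := rankOne_jordanChain_iff_of_kernel (1 : X →L[ℂ] X) 1 (fun _ => rfl) (fun _ => rfl) R (R f)
    (θ • ℓ) h1' hδ' hδ0
  simpa [ContinuousLinearMap.smulRight_apply, smul_eq_mul] using key

end Sentences

section Simple

variable {X : Type*} [NormedAddCommGroup X] [NormedSpace ℂ X] [CompleteSpace X]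
variable {U : Set ℂ} {J : ℂ → X →L[ℂ] X} {z₀ : ℂ} {hinj : Function.Injective (J z₀)}

/-- **Simple zero of the Evans function ⇒ algebraically simple eigenvalue of the unbounded operator `T + θℓ(·)f`.**
If `J` is a pseudo-resolvent on the open set `U ∋ z₀, σ`, `T = operatorOfResolvent J z₀`, and the Evans function
`E(s) = 1 − θ ℓ(J(s) f)` vanishes at `σ` to order exactly one, then: `J(σ) f ≠ 0`; the eigenvectors of `T + θℓ(·)f` at
`σ` are exactly the multiples of `J(σ) f` (geometric multiplicity one); and no eigenvector `δ₀ ≠ 0` has a generalized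
eigenvector `δ₁ ∈ dom T` with `(T + θℓ(·)f − σ)δ₁ = δ₀` (algebraic multiplicity one).
[cite: Kato1966, III-§6.5 and IV-§1.4 Thm. 1.16, elementary rank-one case] -/
theorem algebraicallySimple_of_analyticOrderAt_eq_one (h : IsPseudoResolvent U J) (hU : IsOpen U) (hz₀ : z₀ ∈ U)
    {σ : ℂ} (hσ : σ ∈ U) (ℓ : X →L[ℂ] ℂ) (f : X) (θ : ℂ)
    (hE1 : analyticOrderAt (fun s => 1 - θ * ℓ (J s f)) σ = 1) :
    J σ f ≠ 0 ∧
    (∀ u, (∃ hu : u ∈ (operatorOfResolvent J z₀ hinj).domain,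
        operatorOfResolvent J z₀ hinj ⟨u, hu⟩ = σ • u - (θ * ℓ u) • f) ↔ ∃ t : ℂ, u = t • J σ f) ∧
    ∀ δ₀, δ₀ ≠ 0 → (∃ hu : δ₀ ∈ (operatorOfResolvent J z₀ hinj).domain,
        operatorOfResolvent J z₀ hinj ⟨δ₀, hu⟩ = σ • δ₀ - (θ * ℓ δ₀) • f) →
      ¬ ∃ δ₁, ∃ hu : δ₁ ∈ (operatorOfResolvent J z₀ hinj).domain,
        operatorOfResolvent J z₀ hinj ⟨δ₁, hu⟩ = σ • δ₁ - (θ * ℓ δ₁) • f + δ₀ := by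
  have hEa : AnalyticAt ℂ (fun s => 1 - θ * ℓ (J s f)) σ := h.analyticOnNhd_evans hU ℓ f θ σ hσ
  -- a zero of order one is a zero with non-vanishing derivative
  have hE0 : 1 - θ * ℓ (J σ f) = 0 := by
    by_contra hne
    have h0 := (hEa.analyticOrderAt_eq_zero).2 hne
    rw [h0] at hE1; exact zero_ne_one hE1
  have hd := deriv_ne_zero_of_analyticOrderAt_eq_one hEa hE0 hE1
  rw [h.deriv_evans hU hσ ℓ f θ] at hd
  have h1 : θ * ℓ (J σ f) = 1 := (sub_eq_zero.1 hE0).symm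
  -- geometric part
  have hf0 : J σ f ≠ 0 := by
    intro h0; rw [h0, map_zero, mul_zero] at h1; exact zero_ne_one h1
  refine ⟨hf0, fun u => ?_, fun δ₀ hδ0 hδ => ?_⟩
  · rw [h.eigen_rankOne_iff hz₀ hσ ℓ f θ u]
    constructor
    · intro hu; exact ⟨θ * ℓ u, hu⟩
    · rintro ⟨t, rfl⟩
      rw [map_smul, smul_eq_mul, show θ * (t * ℓ (J σ f)) = t * (θ * ℓ (J σ f)) by ring, h1, mul_one]
  · rintro ⟨δ₁, hδ₁⟩
    rw [h.jordanChain_rankOne_iff hz₀ hσ ℓ f θ δ₀ δ₁] at hδ₁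
    have hδ' : δ₀ = (θ * ℓ δ₀) • J σ f := (h.eigen_rankOne_iff hz₀ hσ ℓ f θ δ₀).1 hδ
    have := (jordanChain_rankOne_iff_of_eigen (J σ) ℓ f θ h1 hδ' hδ0).1 ⟨δ₁, hδ₁⟩
    exact hd this

end Simple

end IsPseudoResolvent

end Literature.Analysis.OperatorTheory
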